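import Summits.HodgeConjecture.CorCM.Census.CyclicCharacterEvenCoordinates

/-!
# Cyclic characters, XXXV: EVEN KERNEL, `d = 0` — LOCAL LINEARISATION FROM ONE FACE PER TYPE, and the canonical lower-left linearisation (`k = 2`)

COR-CM (cell `pub-hodgecm2`), count-neutral kernel combinatorics by the binder seat b09 (gen 44; lane CYCLIC-CHARACTER FIBRE LAW, part XXXV), on parts XIV
(`Census/CyclicCharacterFibreWalk.lean`: the local induction), XVII and XXXIV BY NAME.  Theorems only (no definition, no `decide`, no certificate, no named fact,
no `sorry`).  HONEST FRAMING: `HC_CM` is NOT proved, here or anywhere in the tree; nothing here is a period or a headline.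

* §1 **LOCAL LINEARISATION FROM ONE FACE PER TYPE** (`single_sub_thetaG_mem_of_local`, any `(G, c)`, any base type `T`, any place set `D`): if a lattice `L`
  contains, at EVERY type `Z` deviating from `T` inside `D` at `≥ 2` places, SOME face flipping two of its deviation places, then `[Φ] − NF_T(Φ) ∈ L` for every
  `Φ` deviating inside `D`.  (Part XIVʼs `single_sub_thetaG_mem_span_local` concludes membership in the span of ALL such faces; part XVIIʼs
  `single_sub_thetaG_mem_of_toward` supplies the one face from the toward property under uniqueness of the nearest arc type.  This is the common
  generalisation: the one face may come from anywhere.)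
* §2 **THE CANONICAL LOWER-LEFT LINEARISATION** (`single_sub_normalForm_mem_of_lowerLeft`, `k = 2`, `n = 2m`): let `L` have the toward property and obey the
  LOWER RULE on the bottom edge — every `T_0/T_1`-tie `Z` (`x_0(Z) = m`, potential `< n`) outside an excluded block `E` carries a face of `L` flipping two of
  its `T_0`-deviation places.  Then every type `Y` with `x_0(Y) ≤ m`, `x_1(Y) < m`, none of whose bottom-edge sub-types lies in `E`, satisfies
  `[Y] ≡ [T_0] + Σ_{t ∈ T_0∖Y} ([T_0^{(t)}] − [T_0]) (mod L)`: strictly inside the quadrant the toward face is forced to point to `T_0` (part XXXIV), on the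
  edge the rule supplies it.  §3 transports it along base changes (`single_sub_thetaG_rt_mem_of_lowerLeft`): the same for `Y·g⁻¹` relative to `T_0·g⁻¹`.
These are the linearisations the `d = 0` certificate (parts XXXVI–XXXIX) cashes: the corners of the owned balanced face and the tie `X_B`.

## References
* [Pohlmann1968] H. Pohlmann, Algebraic cycles on abelian varieties of complex multiplication type, Ann. of Math. 88 (1968), Thm 1.
-/

namespace Summit.HodgeConjecture.CorCM.Census.CyclicCharacter

open Finset
open Summit.HodgeConjecture.CorCM.Prior.AllgGroup.RfwfAllgGroup
open Summit.HodgeConjecture.CorCM.Census.BlockParity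
open Summit.HodgeConjecture.CorCM.Census.Coinvariant
open Summit.HodgeConjecture.CorCM.Census.TwistGeneration
open Summit.HodgeConjecture.CorCM.Census.BaseBlock

noncomputable section

variable {G : Type*} [Group G] [Fintype G] [DecidableEq G] {k : ℕ} {w : G → ZMod (2 ^ k)} {c : G}

/-! ## §1 Local linearisation from one face per type -/

/-- **LOCAL LINEARISATION FROM ONE FACE PER TYPE**, `thetaG` form: see the file header. [folklore] -/
theorem single_sub_thetaG_mem_of_local (hc2 : c * c = 1) (L : Submodule ℤ (CMF G c →₀ ℤ)) (T : CMF G c) (D : Finset G)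
    (hloc : ∀ Z : CMF G c, T.1 \ Z.1 ⊆ D → 2 ≤ (T.1 \ Z.1).card →
      ∃ s s' : G, s ∈ T.1 \ Z.1 ∧ s' ∈ T.1 \ Z.1 ∧ s ≠ s' ∧ gface c hc2 Z s s' ∈ L) :
    ∀ (n : ℕ) (Φ : CMF G c), (T.1 \ Φ.1).card = n → T.1 \ Φ.1 ⊆ D →
      Finsupp.single Φ (1 : ℤ) - thetaG c hc2 T (typeSum G c (Finsupp.single Φ 1)) ∈ L := by
  intro n
  induction n using Nat.strong_induction_on with
  | h n ih =>
  intro Φ hn hD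
  rcases n with _ | (_ | m)
  · have hΦ : Φ = T := eq_of_dev_empty c (Finset.card_eq_zero.mp hn)
    rw [hΦ, thetaG_typeSum_single, sdiff_self, Finset.bot_eq_empty, Finset.sum_empty, zero_add, sub_self]
    exact Submodule.zero_mem _
  · obtain ⟨s, hs⟩ := Finset.card_eq_one.mp hn
    have hd : Φ = oflipCM c hc2 s T := eq_oflip_of_dev_singleton c hc2 hs
    rw [thetaG_typeSum_single, hs, Finset.sum_singleton, hd, sub_add_cancel, sub_self]
    exact Submodule.zero_mem _
  · obtain ⟨s, s', hsD, hs'D, hss', hface⟩ := hloc Φ hD (by omega)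
    have hsT : s ∈ T.1 := (Finset.mem_sdiff.mp hsD).1
    have hsΦ : s ∉ Φ.1 := (Finset.mem_sdiff.mp hsD).2
    have hs'T : s' ∈ T.1 := (Finset.mem_sdiff.mp hs'D).1
    have hs'Φ : s' ∉ Φ.1 := (Finset.mem_sdiff.mp hs'D).2
    have hs'O : s' ∉ orb c s := by
      rw [mem_orb]
      rintro (h1 | h1)
      · exact hss' h1.symm
      · exact ((T.2 s).mp hsT) (h1 ▸ hs'T)
    have hdev1 : (T.1 \ (oflipCM c hc2 s Φ).1).card = m + 1 := by
      rw [dev_oflip c hc2 hsT hsΦ, Finset.card_erase_of_mem hsD]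
      omega
    have hdev2 : (T.1 \ (oflipCM c hc2 s' Φ).1).card = m + 1 := by
      rw [dev_oflip c hc2 hs'T hs'Φ, Finset.card_erase_of_mem hs'D]
      omega
    have hsflip : s ∉ (oflipCM c hc2 s' Φ).1 := by
      show s ∉ oflip c s' Φ.1
      have hsO' : s ∉ orb c s' := by
        rw [mem_orb]
        rintro (h1 | h1)
        · exact hss' h1
        · exact ((T.2 s').mp hs'T) (h1 ▸ hsT)
      intro hmem
      rw [oflip, Finset.mem_symmDiff] at hmem
      rcases hmem with ⟨h1, -⟩ | ⟨h1, -⟩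
      · exact hsΦ h1
      · exact hsO' h1
    have hdev3 : (T.1 \ (oflipCM c hc2 s (oflipCM c hc2 s' Φ)).1).card = m := by
      rw [dev_oflip c hc2 hsT hsflip, dev_oflip c hc2 hs'T hs'Φ, Finset.card_erase_of_mem (Finset.mem_erase.mpr ⟨hss', hsD⟩),
        Finset.card_erase_of_mem hs'D]
      omega
    have hD1 : T.1 \ (oflipCM c hc2 s Φ).1 ⊆ D := by
      rw [dev_oflip c hc2 hsT hsΦ]; exact (Finset.erase_subset _ _).trans hD
    have hD2 : T.1 \ (oflipCM c hc2 s' Φ).1 ⊆ D := by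
      rw [dev_oflip c hc2 hs'T hs'Φ]; exact (Finset.erase_subset _ _).trans hD
    have hD3 : T.1 \ (oflipCM c hc2 s (oflipCM c hc2 s' Φ)).1 ⊆ D := by
      rw [dev_oflip c hc2 hsT hsflip, dev_oflip c hc2 hs'T hs'Φ]
      exact ((Finset.erase_subset _ _).trans (Finset.erase_subset _ _)).trans hD
    have key : Finsupp.single Φ (1 : ℤ) - thetaG c hc2 T (typeSum G c (Finsupp.single Φ 1))
        = (gface c hc2 Φ s s'
            - thetaG c hc2 T (typeSum G c (gface c hc2 Φ s s')))
          + (Finsupp.single (oflipCM c hc2 s Φ) (1 : ℤ)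
              - thetaG c hc2 T (typeSum G c (Finsupp.single (oflipCM c hc2 s Φ) 1)))
          + (Finsupp.single (oflipCM c hc2 s' Φ) (1 : ℤ)
              - thetaG c hc2 T (typeSum G c (Finsupp.single (oflipCM c hc2 s' Φ) 1)))
          - (Finsupp.single (oflipCM c hc2 s (oflipCM c hc2 s' Φ)) (1 : ℤ)
              - thetaG c hc2 T (typeSum G c (Finsupp.single (oflipCM c hc2 s (oflipCM c hc2 s' Φ)) 1))) := by
      simp only [gface, map_add, map_sub]
      abel
    rw [key]
    refine Submodule.sub_mem _ (Submodule.add_mem _ (Submodule.add_mem _ ?_ ?_) ?_) ?_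
    · rw [typeSum_gface c hc2 Φ hs'O, map_zero, sub_zero]
      exact hface
    · exact ih (m + 1) (by omega) _ hdev1 hD1
    · exact ih (m + 1) (by omega) _ hdev2 hD2
    · exact ih m (by omega) _ hdev3 hD3

/-- **LOCAL LINEARISATION FROM ONE FACE PER TYPE**, normal form: `[Φ] − ([T] + Σ_{t ∈ T∖Φ} ([T^{(t)}] − [T])) ∈ L` whenever `T ∖ Φ ⊆ D`. [folklore] -/
theorem single_sub_normalForm_mem_of_local (hc2 : c * c = 1) (L : Submodule ℤ (CMF G c →₀ ℤ)) (T : CMF G c) (D : Finset G)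
    (hloc : ∀ Z : CMF G c, T.1 \ Z.1 ⊆ D → 2 ≤ (T.1 \ Z.1).card →
      ∃ s s' : G, s ∈ T.1 \ Z.1 ∧ s' ∈ T.1 \ Z.1 ∧ s ≠ s' ∧ gface c hc2 Z s s' ∈ L)
    (Φ : CMF G c) (hD : T.1 \ Φ.1 ⊆ D) :
    Finsupp.single Φ (1 : ℤ) - ((∑ t ∈ T.1 \ Φ.1, (Finsupp.single (oflipCM c hc2 t T) (1 : ℤ) - Finsupp.single T 1)) + Finsupp.single T 1) ∈ L := by
  rw [← thetaG_typeSum_single hc2 T Φ]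
  exact single_sub_thetaG_mem_of_local hc2 L T D hloc _ Φ rfl hD

/-! ## §2 The canonical lower-left linearisation (`k = 2`) -/

/-- **THE CANONICAL LOWER-LEFT LINEARISATION** (`k = 2`, `n = 2m`), `thetaG` form: under the toward property and the LOWER RULE on the bottom edge outside the
block `E`, every type `Y` with `x_0(Y) ≤ m`, `x_1(Y) < m` and no bottom-edge sub-type in `E` satisfies `[Y] − θ_{T_0}(1_Y) ∈ L`. [folklore] -/
theorem single_sub_thetaG_mem_of_lowerLeft (hw : ∀ P Q : G, w (P * Q) = w P + w Q) (hk : 1 ≤ k) (hk2 : k = 2) (hc2 : c * c = 1) (hwc : w c ≠ 0)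
    (h1 : ∃ g₁ : G, w g₁ = 1) (L : Submodule ℤ (CMF G c →₀ ℤ))
    (htw : ∀ Φ : CMF G c, 2 ≤ bpot c (arcType hw hk hc2 hwc 0) Φ → ∃ Q t t' : G,
      bpot c (arcType hw hk hc2 hwc 0) Φ = ddist (rt c Q (arcType hw hk hc2 hwc 0)) Φ ∧
        t ∈ (rt c Q (arcType hw hk hc2 hwc 0)).1 \ Φ.1 ∧ t' ∈ (rt c Q (arcType hw hk hc2 hwc 0)).1 \ Φ.1 ∧ t ≠ t' ∧ gface c hc2 Φ t t' ∈ L)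
    {m : ℕ} (hm : 2 * m = (univ.filter fun s : G => w s = 0).card) (E : Block c)
    (htie : ∀ Z : CMF G c, blk c Z ≠ E → 2 ≤ bpot c (arcType hw hk hc2 hwc 0) Z →
      bpot c (arcType hw hk hc2 hwc 0) Z < (univ.filter fun s : G => w s = 0).card →
      bpot c (arcType hw hk hc2 hwc 0) Z = ddist (arcType hw hk hc2 hwc 0) Z → bpot c (arcType hw hk hc2 hwc 0) Z = ddist (arcType hw hk hc2 hwc 1) Z →
      ∃ s s' : G, s ∈ (arcType hw hk hc2 hwc 0).1 \ Z.1 ∧ s' ∈ (arcType hw hk hc2 hwc 0).1 \ Z.1 ∧ s ≠ s' ∧ gface c hc2 Z s s' ∈ L)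
    (Y : CMF G c) (hbY : ((univ.filter fun s : G => w s = 0) \ Y.1).card ≤ m) (hvY : ((univ.filter fun s : G => w s = 1) \ Y.1).card < m)
    (hE : ∀ Z : CMF G c, (arcType hw hk hc2 hwc 0).1 \ Z.1 ⊆ (arcType hw hk hc2 hwc 0).1 \ Y.1 →
      ((univ.filter fun s : G => w s = 0) \ Z.1).card = m → blk c Z ≠ E) :
    Finsupp.single Y (1 : ℤ) - thetaG c hc2 (arcType hw hk hc2 hwc 0) (typeSum G c (Finsupp.single Y 1)) ∈ L := by
  refine single_sub_thetaG_mem_of_local hc2 L (arcType hw hk hc2 hwc 0) ((arcType hw hk hc2 hwc 0).1 \ Y.1) (fun Z hZ h2 => ?_) _ Y rfl subset_rfl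
  obtain ⟨hbZ, hvZ⟩ := card_fib_sdiff_le_of_sdiff_subset hw hk hk2 hc2 hwc hZ
  obtain ⟨e0, -, -, -⟩ := ddist_arcType_four hw hk hk2 hc2 hwc h1 Z
  have hd0 : ddist (arcType hw hk hc2 hwc 0) Z = ((arcType hw hk hc2 hwc 0).1 \ Z.1).card := rfl
  have hv2 : 2 * ((univ.filter fun s : G => w s = 1) \ Z.1).card < (univ.filter fun s : G => w s = 0).card := by omega
  by_cases hb2 : 2 * ((univ.filter fun s : G => w s = 0) \ Z.1).card < (univ.filter fun s : G => w s = 0).card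
  · -- strictly inside the quadrant: the toward face points to `T_0`
    obtain ⟨hpot, huniq⟩ := rt_eq_arcType_zero_of_lowerLeft hw hk hk2 hc2 hwc h1 hb2 hv2
    obtain ⟨Q, s, s', hQ, hs, hs', hss', hface⟩ := htw Z (by omega)
    rw [huniq Q hQ] at hs hs'
    exact ⟨s, s', hs, hs', hss', hface⟩
  · -- on the bottom edge: the lower rule
    have hbm : 2 * ((univ.filter fun s : G => w s = 0) \ Z.1).card = (univ.filter fun s : G => w s = 0).card := by omega
    obtain ⟨hpot, hiff⟩ := rt_eq_arcType_zero_or_one_of_bottomEdge hw hk hk2 hc2 hwc h1 hbm hv2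
    obtain ⟨Qm, hQm⟩ := exists_apply_eq hw h1 (-1)
    have eT₁ : arcType hw hk hc2 hwc 1 = rt c Qm (arcType hw hk hc2 hwc 0) := arcType_eq_rt hw hk hc2 hwc hQm
    have hd1 : bpot c (arcType hw hk hc2 hwc 0) Z = ddist (arcType hw hk hc2 hwc 1) Z := by
      rw [eT₁]; exact (hiff Qm).mpr (Or.inr eT₁.symm)
    have hd0' : bpot c (arcType hw hk hc2 hwc 0) Z = ddist (arcType hw hk hc2 hwc 0) Z := by
      have := (hiff 1).mpr (Or.inl (rt_one c _)); rwa [rt_one] at this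
    exact htie Z (hE Z hZ (by omega)) (by omega) (by omega) hd0' hd1

/-- **THE CANONICAL LOWER-LEFT LINEARISATION**, normal form: `[Y] − ([T_0] + Σ_{t ∈ T_0∖Y} ([T_0^{(t)}] − [T_0])) ∈ L`. [folklore] -/
theorem single_sub_normalForm_mem_of_lowerLeft (hw : ∀ P Q : G, w (P * Q) = w P + w Q) (hk : 1 ≤ k) (hk2 : k = 2) (hc2 : c * c = 1) (hwc : w c ≠ 0)
    (h1 : ∃ g₁ : G, w g₁ = 1) (L : Submodule ℤ (CMF G c →₀ ℤ))
    (htw : ∀ Φ : CMF G c, 2 ≤ bpot c (arcType hw hk hc2 hwc 0) Φ → ∃ Q t t' : G,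
      bpot c (arcType hw hk hc2 hwc 0) Φ = ddist (rt c Q (arcType hw hk hc2 hwc 0)) Φ ∧
        t ∈ (rt c Q (arcType hw hk hc2 hwc 0)).1 \ Φ.1 ∧ t' ∈ (rt c Q (arcType hw hk hc2 hwc 0)).1 \ Φ.1 ∧ t ≠ t' ∧ gface c hc2 Φ t t' ∈ L)
    {m : ℕ} (hm : 2 * m = (univ.filter fun s : G => w s = 0).card) (E : Block c)
    (htie : ∀ Z : CMF G c, blk c Z ≠ E → 2 ≤ bpot c (arcType hw hk hc2 hwc 0) Z →
      bpot c (arcType hw hk hc2 hwc 0) Z < (univ.filter fun s : G => w s = 0).card →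
      bpot c (arcType hw hk hc2 hwc 0) Z = ddist (arcType hw hk hc2 hwc 0) Z → bpot c (arcType hw hk hc2 hwc 0) Z = ddist (arcType hw hk hc2 hwc 1) Z →
      ∃ s s' : G, s ∈ (arcType hw hk hc2 hwc 0).1 \ Z.1 ∧ s' ∈ (arcType hw hk hc2 hwc 0).1 \ Z.1 ∧ s ≠ s' ∧ gface c hc2 Z s s' ∈ L)
    (Y : CMF G c) (hbY : ((univ.filter fun s : G => w s = 0) \ Y.1).card ≤ m) (hvY : ((univ.filter fun s : G => w s = 1) \ Y.1).card < m)
    (hE : ∀ Z : CMF G c, (arcType hw hk hc2 hwc 0).1 \ Z.1 ⊆ (arcType hw hk hc2 hwc 0).1 \ Y.1 →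
      ((univ.filter fun s : G => w s = 0) \ Z.1).card = m → blk c Z ≠ E) :
    Finsupp.single Y (1 : ℤ) - ((∑ t ∈ (arcType hw hk hc2 hwc 0).1 \ Y.1,
      (Finsupp.single (oflipCM c hc2 t (arcType hw hk hc2 hwc 0)) (1 : ℤ) - Finsupp.single (arcType hw hk hc2 hwc 0) 1)) +
        Finsupp.single (arcType hw hk hc2 hwc 0) 1) ∈ L := by
  rw [← thetaG_typeSum_single hc2]
  exact single_sub_thetaG_mem_of_lowerLeft hw hk hk2 hc2 hwc h1 L htw hm E htie Y hbY hvY hE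

/-! ## §3 Transport along a base change -/

/-- **TRANSPORTED LOWER-LEFT LINEARISATION**: for a `G`-stable `L` as in §2 and any `g`, the base change `Y·g⁻¹` is linearised toward `T_0·g⁻¹`:
`[Y·g⁻¹] − θ_{T_0·g⁻¹}(1_{Y·g⁻¹}) ∈ L`. [folklore] -/
theorem single_sub_thetaG_rt_mem_of_lowerLeft (hw : ∀ P Q : G, w (P * Q) = w P + w Q) (hk : 1 ≤ k) (hk2 : k = 2) (hc2 : c * c = 1) (hwc : w c ≠ 0)
    (h1 : ∃ g₁ : G, w g₁ = 1) (L : Submodule ℤ (CMF G c →₀ ℤ)) (hLG : ∀ (Q : G) (y : CMF G c →₀ ℤ), y ∈ L → Finsupp.mapDomain (rt c Q) y ∈ L)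
    (htw : ∀ Φ : CMF G c, 2 ≤ bpot c (arcType hw hk hc2 hwc 0) Φ → ∃ Q t t' : G,
      bpot c (arcType hw hk hc2 hwc 0) Φ = ddist (rt c Q (arcType hw hk hc2 hwc 0)) Φ ∧
        t ∈ (rt c Q (arcType hw hk hc2 hwc 0)).1 \ Φ.1 ∧ t' ∈ (rt c Q (arcType hw hk hc2 hwc 0)).1 \ Φ.1 ∧ t ≠ t' ∧ gface c hc2 Φ t t' ∈ L)
    {m : ℕ} (hm : 2 * m = (univ.filter fun s : G => w s = 0).card) (E : Block c)
    (htie : ∀ Z : CMF G c, blk c Z ≠ E → 2 ≤ bpot c (arcType hw hk hc2 hwc 0) Z →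
      bpot c (arcType hw hk hc2 hwc 0) Z < (univ.filter fun s : G => w s = 0).card →
      bpot c (arcType hw hk hc2 hwc 0) Z = ddist (arcType hw hk hc2 hwc 0) Z → bpot c (arcType hw hk hc2 hwc 0) Z = ddist (arcType hw hk hc2 hwc 1) Z →
      ∃ s s' : G, s ∈ (arcType hw hk hc2 hwc 0).1 \ Z.1 ∧ s' ∈ (arcType hw hk hc2 hwc 0).1 \ Z.1 ∧ s ≠ s' ∧ gface c hc2 Z s s' ∈ L)
    (Y : CMF G c) (hbY : ((univ.filter fun s : G => w s = 0) \ Y.1).card ≤ m) (hvY : ((univ.filter fun s : G => w s = 1) \ Y.1).card < m)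
    (hE : ∀ Z : CMF G c, (arcType hw hk hc2 hwc 0).1 \ Z.1 ⊆ (arcType hw hk hc2 hwc 0).1 \ Y.1 →
      ((univ.filter fun s : G => w s = 0) \ Z.1).card = m → blk c Z ≠ E) (g : G) :
    Finsupp.single (rt c g Y) (1 : ℤ) - thetaG c hc2 (rt c g (arcType hw hk hc2 hwc 0)) (typeSum G c (Finsupp.single (rt c g Y) 1)) ∈ L := by
  have h := hLG g _ (single_sub_thetaG_mem_of_lowerLeft hw hk hk2 hc2 hwc h1 L htw hm E htie Y hbY hvY hE)
  rwa [Finsupp.mapDomain_sub, Finsupp.mapDomain_single, mapDomain_rt_thetaG] at h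

end

end Summit.HodgeConjecture.CorCM.Census.CyclicCharacter
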